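import Summits.ResolutionOfSingularities.ResolutionOfSingularities.Theorems.InertDescentLU3
import Summits.ResolutionOfSingularities.ResolutionOfSingularities.Theorems.DecompositionDescentLU3
import HarnessLib

/-!
# InertDescentLU (4/5) — THE LAW: `UnramifiedWitnessLUAbove k O → RelLocalUniformization k K O`, hypothesis-free

Part 4 of the g28 node `InertDescentLU` of the ROOT/RESIDUAL decomposition cell `decomp-res` (lens 1, window
(W-inert) of critic row 207); see the module docstring of
`Summits.ResolutionOfSingularities.ResolutionOfSingularities.Theorems.InertDescentLU` (part 1/5) for the thesis, the engine
(faithfully flat descent of regularity [Matsumura 23.7 (i)] + standard-étale over normal is normal [Stacks 03GD]),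
the law `UnramifiedWitnessLUAbove k O → RelLocalUniformization k K O`, the residual R28, the cuts and the sources.
Problem side, sorry-free, hypothesis-free.

This part (imports g27's slice `DecompositionDescentLU3` for the verbatim cell): `relLU_of_unramifiedWitnessLUAbove`
(kernel; engine = parts 1–3) and `not_decWitnessLUAbove_of_not_unramifiedWitnessLUAbove`.
-/

noncomputable section

open IsLocalRing Polynomial Literature.AlgebraicGeometry.Resolution

namespace Summit.ResolutionOfSingularities.ResolutionOfSingularities.Theorems.InertDescentLU

universe u

variable {E : Type u} [Field E] (OE : ValuationSubring E)

/-! ## PART D (summit frame) — THE LAW `UnramifiedWitnessLUAbove k O → RelLocalUniformization k K O`,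
hypothesis-free -/

section Law

variable {k K : Type} [Field k] [Field K] [Algebra k K]

open Summit.ResolutionOfSingularities.ResolutionOfSingularities.Theorems.DecompositionDescentLU

set_option maxHeartbeats 1600000 in
/-- **THE INERT-DESCENT LAW (kernel, HYPOTHESIS-FREE; window item (W-inert) of critic row 207):
`UnramifiedWitnessLUAbove k O → RelLocalUniformization k K O`** on g27's VERBATIM residue-free witness cell.
Given a model `R ⊆ O` of `K | k`: the cell's clause FOR `R` ITSELF gives an enlargement `t ⊆ O` and finitely
many witnesses `x′ ⊆ O_E`, each a root of a monic `g ∈ R[t][X]` with `v(g′(x′)) = 0`, such that `R[t][x′]` is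
regular at the centre of `O_E`; read everything in `L = K̄` over the subfield `M = K` (`s = ι(gens(R) ∪ t)`,
`k[s ∪ x′]` regular at the centre); THE ENGINE `exists_normalModel_regular_of_witnesses` (normal model
`k[t₁] ⊇ k[s]` of `M`; `(k[t₁ ∪ x′])_𝔪 = (k[s ∪ x′])_𝔪`; normality and Noetherianity go UP the witness tower by
[Stacks 03GD], regularity comes DOWN by faithfully flat descent [Matsumura 23.7 (i)]) makes `k[t₁]` regular at
the centre; pull `t₁ ⊆ M = ι(K)` back to `K` and transport the local ring along `K ≅ ι(K)`.  NO decomposition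
group, NO Galois closure, NO residue clause, NO completion, NO fact binder (F2′ = Mathlib 03GD, F3⁺ = the tree's
`IsRegularLocalRing.of_flat_of_isLocalHom`).  Supersedes g27's `relLU_of_decWitnessLUAbove` on the larger cell
(`decWitness_le_unramifiedWitness`). (Sources: CossartPiltant2008, Prop. 9.3 and Problem 9.2 (HAL pp. 26–28);
Matsumura1986, Thm. 23.7 (i), p. 181; StacksProject, Tag 03GD.) -/
theorem relLU_of_unramifiedWitnessLUAbove {O : ValuationSubring K} (h : UnramifiedWitnessLUAbove k O) :
    RelLocalUniformization k K O := by
  classical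
  intro R hRfg hRfrac hRO
  obtain ⟨OE, hOE, K', -, -, hLU⟩ := h
  haveI := hRfrac
  let L := AlgebraicClosure K
  let ι : K →+* L := algebraMap K L
  have hιinj : Function.Injective ι := (algebraMap K L).injective
  let φ : K →ₐ[k] L := IsScalarTower.toAlgHom k K L
  have hφ : ∀ x : K, φ x = ι x := fun _ => rfl
  -- (1) membership in `O` and `v < 1` are read upstairs (`O = O_E ∩ K`)
  have hmemO : ∀ x : K, x ∈ O ↔ ι x ∈ OE := fun x => by
    rw [← hOE]; rfl
  have hvalO : ∀ y : K, O.valuation y < 1 ↔ OE.valuation (ι y) < 1 := fun y => by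
    rw [← valuation_comap_lt_one_iff OE ι y, hOE]
  -- (2) the subfield `M = K` of `L = K̄`
  let M : Subfield L := ι.fieldRange
  have hMmem : ∀ y : L, y ∈ M ↔ ∃ x : K, ι x = y := fun y => RingHom.mem_fieldRange
  have hιM : ∀ x : K, ι x ∈ M := fun x => (hMmem _).mpr ⟨x, rfl⟩
  have hkM : ∀ c : k, algebraMap k L c ∈ M := fun c => by
    rw [IsScalarTower.algebraMap_apply k K L]; exact hιM _
  have hkO : ∀ c : k, algebraMap k L c ∈ OE := fun c => by
    rw [IsScalarTower.algebraMap_apply k K L, ← hmemO]; exact hRO (R.algebraMap_mem c)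
  -- (3) the cell's clause FOR `R` ITSELF (no enlargement, no Galois closure): `t`, witnesses `x′`, regularity
  obtain ⟨t, htO, x', -, hwit, hregT⟩ := hLU R hRfg inferInstance hRO
  obtain ⟨s₀, rfl⟩ := hRfg
  -- (4) the generators `s = ι(s₀ ∪ t)` of `R[t]` read in `L`
  let sK : Finset K := s₀ ∪ t
  let s : Finset L := sK.image ι
  have hsKO : ∀ x ∈ sK, x ∈ O := by
    intro x hx
    rcases Finset.mem_union.mp hx with hx | hx
    · exact hRO (Algebra.subset_adjoin hx)
    · exact htO x hx
  have hsM : (s : Set L) ⊆ M := by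
    intro z hz
    rw [Finset.coe_image] at hz
    obtain ⟨x, -, rfl⟩ := hz
    exact hιM x
  have hsO : ∀ z ∈ s, z ∈ OE := by
    intro z hz
    obtain ⟨x, hx, rfl⟩ := Finset.mem_image.mp hz
    exact (hmemO x).mp (hsKO x hx)
  have hRt : Algebra.adjoin k ((Algebra.adjoin k (s₀ : Set K) : Set K) ∪ (t : Set K)) =
      Algebra.adjoin k (sK : Set K) := by
    apply le_antisymm
    · refine Algebra.adjoin_le (Set.union_subset (fun x hx => ?_) (fun x hx => ?_))
      · refine (Algebra.adjoin_mono ?_) hx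
        intro y hy
        simp only [sK, Finset.coe_union]
        exact Or.inl hy
      · apply Algebra.subset_adjoin
        simp only [sK, Finset.coe_union]
        exact Or.inr hx
    · refine Algebra.adjoin_le ?_
      intro x hx
      simp only [sK, Finset.coe_union] at hx
      rcases hx with hx | hx
      · exact Algebra.subset_adjoin (Or.inl (Algebra.subset_adjoin hx))
      · exact Algebra.subset_adjoin (Or.inr hx)
  have hmapS : (Algebra.adjoin k (sK : Set K)).map φ = Algebra.adjoin k (s : Set L) := by
    rw [AlgHom.map_adjoin]
    simp only [s, Finset.coe_image]
    rfl
  have hmemS : ∀ x : K, x ∈ Algebra.adjoin k (sK : Set K) → ι x ∈ Algebra.adjoin k (s : Set L) :=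
    fun x hx => by
      rw [← hmapS]; exact Subalgebra.mem_map.mpr ⟨x, hx, rfl⟩
  have hRs : (Algebra.adjoin k (s₀ : Set K)).map φ ≤ Algebra.adjoin k (s : Set L) := by
    intro z hz
    obtain ⟨x, hx, rfl⟩ := Subalgebra.mem_map.mp hz
    exact hmemS x (by rw [← hRt]; exact Algebra.subset_adjoin (Or.inl hx))
  have hadj_cl : (Algebra.adjoin k (s : Set L) : Set L) ⊆
      (Subfield.closure (Set.range (algebraMap k L) ∪ (s : Set L)) : Set L) := by
    intro z hz
    rw [SetLike.mem_coe, ← Subalgebra.mem_toSubring, Algebra.adjoin_eq_ring_closure] at hz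
    exact Subring.closure_le.mpr (fun w hw => Subfield.subset_closure hw) hz
  have hMs : M ≤ Subfield.closure (Set.range (algebraMap k L) ∪ (s : Set L)) := by
    intro y hy
    obtain ⟨x, rfl⟩ := (hMmem y).mp hy
    obtain ⟨a, b, -, hab⟩ := IsFractionRing.div_surjective (A := Algebra.adjoin k (s₀ : Set K)) x
    rw [← hab, map_div₀]
    refine div_mem (hadj_cl (hRs ?_)) (hadj_cl (hRs ?_))
    · exact Subalgebra.mem_map.mpr ⟨a, a.2, rfl⟩
    · exact Subalgebra.mem_map.mpr ⟨b, b.2, rfl⟩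
  -- (5) the upstairs model of the cell is `k[s ∪ x′]`, regular at the centre
  have hTeq : Algebra.adjoin k (ι '' ((Algebra.adjoin k (s₀ : Set K) : Set K) ∪ (t : Set K)) ∪ (x' : Set L)) =
      Algebra.adjoin k ((s : Set L) ∪ (x' : Set L)) := by
    apply le_antisymm
    · refine Algebra.adjoin_le (Set.union_subset ?_ (fun z hz => Algebra.subset_adjoin (Or.inr hz)))
      rintro _ ⟨x, hx, rfl⟩
      refine (Algebra.adjoin_mono Set.subset_union_left) (hmemS x ?_)
      rw [← hRt]; exact Algebra.subset_adjoin hx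
    · refine Algebra.adjoin_le (Set.union_subset ?_ (fun z hz => Algebra.subset_adjoin (Or.inr hz)))
      intro z hz
      obtain ⟨x, hx, rfl⟩ := Finset.mem_image.mp hz
      refine Algebra.subset_adjoin (Or.inl ⟨x, ?_, rfl⟩)
      rcases Finset.mem_union.mp hx with hx | hx
      · exact Or.inl (Algebra.subset_adjoin hx)
      · exact Or.inr hx
  have hregT' : IsRegularLocalRing
      (locAtCentre (Algebra.adjoin k ((s : Set L) ∪ (x' : Set L))).toSubring OE) := by
    rw [← hTeq]; exact hregT
  -- (6) the witness data read in `L`, over the model `k[s]`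
  have hw : ∀ x ∈ x', x ∈ OE ∧ ∃ f : Polynomial L, (∀ i, f.coeff i ∈ Algebra.adjoin k (s : Set L)) ∧
      f.Monic ∧ f.eval x = 0 ∧ OE.valuation ((Polynomial.derivative f).eval x) = 1 := by
    intro x hx
    obtain ⟨hxO, g, hgm, hgR, hgx, hgder⟩ := hwit x hx
    refine ⟨hxO, g.map ι, fun i => ?_, hgm.map ι, ?_, ?_⟩
    · rw [Polynomial.coeff_map]
      exact hmemS _ (by rw [← hRt]; exact hgR i)
    · rw [Polynomial.eval_map, ← Polynomial.aeval_def]; exact hgx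
    · rw [Polynomial.derivative_map, Polynomial.eval_map, ← Polynomial.aeval_def]; exact hgder
  -- (7) THE ENGINE: the normal model `k[t₁] ⊇ k[s]` of `M` is regular at the centre of `O_E`
  obtain ⟨t₁, ht₁M, hst₁, ht₁O, hreg₁⟩ :=
    exists_normalModel_regular_of_witnesses OE k hkM hkO s hsM hsO hMs x' hw hregT'
  -- (8) pull the model back to `K`
  have ht₁K : (t₁ : Set L) ⊆ Set.range ι := fun z hz => (hMmem z).mp (ht₁M hz)
  let tK : Finset K := t₁.preimage ι hιinj.injOn
  have hιtK : ι '' (tK : Set K) = (t₁ : Set L) := by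
    rw [Finset.coe_preimage]; exact Set.image_preimage_eq_of_subset ht₁K
  let A₀ : Subalgebra k K := Algebra.adjoin k (tK : Set K)
  have hA₀map : A₀.map φ = Algebra.adjoin k (t₁ : Set L) := by
    rw [AlgHom.map_adjoin, ← hιtK]; rfl
  have hmemA₀ : ∀ x : K, x ∈ A₀ ↔ ι x ∈ Algebra.adjoin k (t₁ : Set L) := fun x => by
    rw [← hA₀map, Subalgebra.mem_map]
    constructor
    · exact fun hx => ⟨x, hx, rfl⟩
    · rintro ⟨y, hy, hyx⟩
      rwa [← hιinj hyx]
  have hRt₁ : (Algebra.adjoin k (s₀ : Set K)).map φ ≤ Algebra.adjoin k (t₁ : Set L) :=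
    hRs.trans (Algebra.adjoin_mono hst₁)
  have hRA₀ : Algebra.adjoin k (s₀ : Set K) ≤ A₀ := fun x hx =>
    (hmemA₀ x).mpr (hRt₁ (Subalgebra.mem_map.mpr ⟨x, hx, rfl⟩))
  have hA₀fg : A₀.FG := ⟨tK, rfl⟩
  have hA₀O : A₀.toSubring ≤ O.toSubring := fun x hx => (hmemO x).mpr (ht₁O ((hmemA₀ x).mp hx))
  refine ⟨A₀, hA₀O, hRA₀, hA₀fg, ?_⟩
  -- (9) transport of the local ring at the centre along `K ↪ K̄`
  have hT : A₀.toSubring.map ι = (Algebra.adjoin k (t₁ : Set L)).toSubring := by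
    ext y
    rw [Subring.mem_map]
    constructor
    · rintro ⟨x, hx, rfl⟩
      exact (hmemA₀ x).mp hx
    · intro hy
      have hy' : y ∈ A₀.map φ := by rw [hA₀map]; exact hy
      obtain ⟨x, hx, rfl⟩ := Subalgebra.mem_map.mp hy'
      exact ⟨x, hx, rfl⟩
  let g : A₀.toSubring ≃+* (Algebra.adjoin k (t₁ : Set L)).toSubring :=
    (A₀.toSubring.equivMapOfInjective ι hιinj).trans (RingEquiv.subringCongr hT)
  have hg : ∀ x : A₀.toSubring, ((g x : (Algebra.adjoin k (t₁ : Set L)).toSubring) : L) = ι x :=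
    fun _ => rfl
  set P : Ideal A₀.toSubring := Ideal.comap (Subring.inclusion hA₀O) (IsLocalRing.maximalIdeal O) with hP
  set P' : Ideal (Algebra.adjoin k (t₁ : Set L)).toSubring :=
    Ideal.comap (Subring.inclusion ht₁O) (IsLocalRing.maximalIdeal OE) with hP'
  haveI : P'.IsPrime := Ideal.IsPrime.comap _
  haveI : P.IsPrime := Ideal.IsPrime.comap _
  haveI hregP' : IsRegularLocalRing (Localization.AtPrime P') :=
    (isRegularLocalRing_locAtCentre_iff ht₁O).mp hreg₁
  have hPP' : P = P'.comap g.toRingHom := by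
    ext x
    simp only [hP, hP', Ideal.mem_comap, RingEquiv.toRingHom_eq_coe, RingHom.coe_coe]
    rw [ValuationSubring.valuation_lt_one_iff, ValuationSubring.valuation_lt_one_iff]
    change O.valuation (x : K) < 1 ↔ OE.valuation ((g x : (Algebra.adjoin k (t₁ : Set L)).toSubring) : L) < 1
    rw [hg]
    exact hvalO x
  have hmap : Submonoid.map g.toRingHom.toMonoidHom P.primeCompl = P'.primeCompl := by
    ext y
    constructor
    · rintro ⟨x, hx, rfl⟩
      change g x ∉ P'
      have hx' : x ∉ P := hx
      rw [hPP', Ideal.mem_comap] at hx'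
      exact hx'
    · intro hy
      have hy' : y ∉ P' := hy
      refine ⟨g.symm y, ?_, ?_⟩
      · change g.symm y ∉ P
        rw [hPP', Ideal.mem_comap]
        change ¬ g (g.symm y) ∈ P'
        rw [g.apply_symm_apply]
        exact hy'
      · change g (g.symm y) = y
        exact g.apply_symm_apply y
  exact IsRegularLocalRing.of_ringEquiv (R := Localization.AtPrime P')
    (IsLocalization.ringEquivOfRingEquiv (Localization.AtPrime P) (Localization.AtPrime P') g hmap).symm

/-- Forgetting is not invertible, but NEGATION is monotone the right way for the cut: off the residue-free cell
one is off the decomposition-witness cell (`decWitness_le_unramifiedWitness`, g27). [folklore] -/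
theorem not_decWitnessLUAbove_of_not_unramifiedWitnessLUAbove {O : ValuationSubring K}
    (h : ¬ UnramifiedWitnessLUAbove k O) : ¬ DecWitnessLUAbove k O :=
  fun hW => h (decWitness_le_unramifiedWitness hW)

end Law

end Summit.ResolutionOfSingularities.ResolutionOfSingularities.Theorems.InertDescentLU

end
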